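import Summits.Parity.GeneralizedHardyLittlewood.Theorems.PrimeLevelFamEdgeMomentsBeyondDiagonalDiagRemP2MoebiusAsymp
import Literature.NumberTheory.Sieve.GoldstonYildirimLemma21MoebiusSumProofs
import HarnessLib

/-!
# Route `PrimeLevelFamEdge`, crux K_A `MomentsBeyondDiagonal` (stmt-Parity-20007), line «petersson_layers» v4, stub `stub_diag`:
# **`Σ_{d ≤ y} μ(d)P₂(d)/d = −log y + c_F + O((log y)⁻ⁿ)`, unconditionally** (L3 of the (P2TAIL) chain, closed)

`…DiagRemP2MoebiusAsymp.sum_moebius_primeSq_div_asymp_of` with its hypothesis discharged by the tree's PROVED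
`Literature.NumberTheory.Sieve.goldstonYildirim_lemma21_j0_holds` (Goldston–Yıldırım, Lemma 2.1 (2.13) at `j = 0`). Kept in its own
file only to keep the proofs module of that fact out of the import closure of the other (P2TAIL) bricks.

* `sum_moebius_primeSq_div_asymp` — **`∃ c_F, ∀ n, ∃ K, ∀ y ≥ 4: |Σ_{d ≤ y} μ(d)/d·Σ_{p∣d}log²p + log y − c_F| ≤ K/(log y)ⁿ`.**

Def-free; theorems only. Helper `--supports stmt-Parity-20007`; closes nothing; K_A, K_B and the Parity summit are NOT proved;
nothing about Landau–Siegel zeros.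

## References
* G. H. Hardy, E. M. Wright, *An Introduction to the Theory of Numbers*, 6th ed., §22.15–§22.16.
  [cite: HardyWright2008, §22.15 — derivation (with the de la Vallée-Poussin rate)]
-/

noncomputable section

open Finset Real
open scoped ArithmeticFunction.Moebius

namespace Summit.Parity.GeneralizedHardyLittlewood.Theorems.MomentsBeyondDiagonal.DiagCorner

open Literature.NumberTheory.Sieve (goldstonYildirim_lemma21_j0_holds)

/-- **`Σ_{d ≤ y} μ(d)P₂(d)/d = −log y + c_F + O((log y)⁻ⁿ)`** (every `n`; `y ≥ 4`; `c_F = −ρ/2`, `ρ` the constant of `R₂`).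
[cite: HardyWright2008, §22.15 — derivation (with the de la Vallée-Poussin rate)] -/
theorem sum_moebius_primeSq_div_asymp : ∃ cF : ℝ, ∀ n : ℕ, ∃ K : ℝ, ∀ y : ℝ, 4 ≤ y →
    |(∑ d ∈ Icc 1 ⌊y⌋₊, (ArithmeticFunction.moebius d : ℝ) / d * ∑ p ∈ d.primeFactors, Real.log p ^ 2) +
        Real.log y - cF| ≤ K / Real.log y ^ n :=
  sum_moebius_primeSq_div_asymp_of goldstonYildirim_lemma21_j0_holds

end Summit.Parity.GeneralizedHardyLittlewood.Theorems.MomentsBeyondDiagonal.DiagCorner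

end
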